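import Literature.Geometry.Lorentzian.InteriorKerrGluing
import Literature.Geometry.Lorentzian.KerrSchildDivergence
import Literature.Geometry.Lorentzian.SchwarzschildKerrSchildComponents
import Literature.Geometry.Lorentzian.UnitNormalUniqueness
import Literature.Geometry.Lorentzian.ChartSecondFundamentalForm
import HarnessLib

/-!
# The cylinder `{r = r₀}`, `r₋ < r₀ < r₊`, of Kerr is a spacelike hypersurface with future unit
# normal `g♯dr/|g♯dr|` (the frame of the conclusion of Li–Mei 2020, Prop. 4.1)

Support file (all results proved; no named facts) for the named fact `LiMei.interiorKerrGluing`
(`InteriorKerrGluing.lean`; J. Li, H. Mei, *A construction of collapsing spacetimes in vacuum*,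
Comm. Math. Phys. 378 (2020) = arXiv:2005.01249, Prop. 4.1). Its conclusion "Kerrian near `t₂`"
is transported as `LiMei.IsKerrCylinderOn m a r₀ τ₀ R s D'`, whose frame clauses ask that the
standard Kerr cylinder map `ψ = kerrCylMap r₀ a τ₀ R : y ↦ (‖y‖ + τ₀, ellipsoidPt r₀ a (R (y/‖y‖)))`
onto `{Kerr.radius a = r₀}` be a SPACELIKE IMMERSION with a FUTURE UNIT NORMAL, for the glued
parameters `|a| < m`, `r₋(m, a) < r₀ < r₊(m, a)`. This is the sentence opening §4 of the print
(arXiv p. 22): "for any `r₀ ∈ (r₋, r₊)`, the hypersurface `r = r₀` is a spacelike hypersurface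
inside the black hole" — proved here for every spin, in the tree's ingoing Kerr–Schild chart:

* `Kerr.radiusSharp M a x = (0, ∇r) − 2H ℓ♯` is the vector `g♯dr` (`g⁻¹ = η⁻¹ − 2H ℓ♯ ⊗ ℓ♯`,
  `dr(ℓ♯) = ℓ⃗ · ∇r = 1`): `Kerr.bilin_radiusSharp` (`g(g♯dr, w) = dr(w) = ⟪∇r, w⃗⟫`),
  `Kerr.bilin_radiusSharp_self` (**`g(g♯dr, g♯dr) = g^{rr} = Δ(r)/Σ`**, `Δ = r² − 2Mr + a²`,
  `Σ = r² + a² cos²θ`, from `|∇r|² = (r² + a²)/Σ` and `H = Mr/Σ`), `Kerr.bilin_timeVector_radiusSharp`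
  (`g(V, g♯dr) = −2H < 0`: `g♯dr` is future-directed for `M > 0`), `Kerr.delta_neg`
  (`Δ(r₀) < 0` for `r₋ < r₀ < r₊`, `|a| ≤ m`: the cylinder conormal is timelike between the horizons);
* `LiMei.hasFDerivAt_kerrCylMap`, `LiMei.kerrCylDeriv_injective`,
  `LiMei.inner_radiusGradVec_kerrCylDeriv` — the differential of the cylinder map, its injectivity,
  and tangency `dr(dψ v) = 0` (`r ∘ ψ ≡ r₀`);
* `LiMei.isSpacelikeImmersion_kerrCyl` — **the Kerr cylinder frame is a smooth spacelike immersion**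
  (a nonzero vector `g`-orthogonal to the timelike `g♯dr` is spacelike, `Kerr.bilin_pos_of_orthogonal`);
* `LiMei.kerrCylUnitNormal m a x = (−g^{rr})^{-1/2} g♯dr`, `LiMei.isFutureUnitNormal_kerrCylUnitNormal`,
  `LiMei.eq_kerrCylUnitNormal` — **its future unit normal, and uniqueness** (codimension one,
  `UnitNormalUniqueness.lean`): the frame clauses of `LiMei.IsKerrCylinderOn` are satisfiable for
  all admissible parameters, and the `∃ ν` there is pinned pointwise.

## References

* J. Li, H. Mei, *A construction of collapsing spacetimes in vacuum*, Comm. Math. Phys. 378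
  (2020), arXiv:2005.01249, §4, p. 22 and Prop. 4.1 (key `LiMei2020`).
* B. O'Neill, *The geometry of Kerr black holes* (1995), Ch. 2, §2.3–§2.5 (`Δ`, `r±`, the
  `r`-hypersurfaces are spacelike between the horizons) (key `ONeill1995`); *Semi-Riemannian
  geometry* (1983), Ch. 5, Lemma 5.26 (key `ONeill1983`).
* M. Visser, *The Kerr spacetime: a brief introduction*, arXiv:0706.0622, (32)–(35) and §5
  (`g^{ab} = η^{ab} − 2H ℓ^a ℓ^b`) (key `arXiv07060622`).
-/

noncomputable section

open Bundle Set TopologicalSpace Manifold Module Filter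
open scoped Manifold ContDiff Topology RealInnerProductSpace

namespace Literature.Geometry.Lorentzian

namespace Kerr

/-! ### The vector `g♯dr` of the Kerr–Schild chart -/

/-- `ℓ(0, u) = ⟪ℓ⃗, u⟫`: the Kerr–Schild covector on a purely spatial vector. Visser
arXiv:0706.0622, (34). [cite: arXiv07060622, (34)] -/
theorem nullCovector_spaceEmbed_eq_inner (a : ℝ) (x : E4) (u : E3) :
    nullCovector a x (E4.spaceEmbed u) = ⟪nullSpatial a x, u⟫ := by
  rw [nullCovector, E4.covector_apply, Fin.sum_univ_four]
  simp only [E4.spaceEmbed_apply, E4.ofTimeSpace_apply_zero, mul_zero, zero_add, PiLp.inner_apply,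
    RCLike.inner_apply, conj_trivial, Fin.sum_univ_three, nullSpatial_apply, Fin.succ_zero_eq_one,
    Fin.succ_one_eq_two, Fin.isValue]
  have h1 : (E4.ofTimeSpace 0 u) 1 = u 0 := E4.ofTimeSpace_apply_succ 0 u 0
  have h2 : (E4.ofTimeSpace 0 u) 2 = u 1 := E4.ofTimeSpace_apply_succ 0 u 1
  have h3 : (E4.ofTimeSpace 0 u) 3 = u 2 := E4.ofTimeSpace_apply_succ 0 u 2
  have h4 : (2 : Fin 3).succ = (3 : Fin 4) := rfl
  simp only [h1, h2, h3, h4]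
  ring

/-- `η((0, u), w) = ⟪u, w⃗⟫`. O'Neill 1983, Ch. 3, p. 55. [cite: ONeill1983, Ch. 3, p. 55] -/
theorem minkowski_bilin_spaceEmbed_left (u : E3) (w : E4) :
    Minkowski.bilin (E4.spaceEmbed u) w = ⟪u, E4.spatial w⟫ := by
  rw [minkowski_bilin_eq_spatial]
  simp

/-- **The vector `g♯dr`** of the Kerr–Schild chart at `x`: with `g⁻¹ = η⁻¹ − 2H ℓ♯ ⊗ ℓ♯`
(Visser arXiv:0706.0622, §5) and `dr(ℓ♯) = ℓ⃗ · ∇r = 1` (`radiusGrad_nullSpatial`),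
`g♯dr = η♯dr − 2H dr(ℓ♯) ℓ♯ = (0, ∇r) − 2H ℓ♯`, `∇r = radiusGradVec a x⃗` the spatial gradient of
the Kerr–Schild radius. It is the (unnormalised) normal vector of the cylinders `{r = const}`.
[cite: arXiv07060622, (35) and §5] -/
def radiusSharp (M a : ℝ) (x : E4) : E4 :=
  E4.spaceEmbed (radiusGradVec a (E4.spatial x)) - (2 * scalarH M a x) • nullVector a x

/-- `ℓ(g♯dr) = ℓ⃗ · ∇r = 1` (`ℓ(ℓ♯) = 0`). Visser arXiv:0706.0622, (34)–(35). [cite: arXiv07060622, (34)–(35)] -/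
theorem nullCovector_radiusSharp (M : ℝ) {a : ℝ} {x : E4} (hx : 0 < radius a x) :
    nullCovector a x (radiusSharp M a x) = 1 := by
  rw [radiusSharp, map_sub, map_smul, nullCovector_nullVector hx, smul_eq_mul, mul_zero, sub_zero,
    nullCovector_spaceEmbed_eq_inner]
  have hr : 0 < radius a (E4.ofTimeSpace 0 (E4.spatial x)) := by rwa [radius_ofTimeSpace_spatial]
  have h := radiusGrad_nullSpatial (a := a) (E4.time x) hr
  rw [E4.ofTimeSpace_time_spatial, radiusGrad_apply] at h
  rwa [real_inner_comm]

/-- **`g(g♯dr, w) = dr(w) = ⟪∇r, w⃗⟫`** for every `w`: `η((0, ∇r), w) = ⟪∇r, w⃗⟫`,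
`η(ℓ♯, w) = ℓ(w)`, `ℓ(g♯dr) = 1`, so the `2H ℓ ⊗ ℓ` terms cancel. Visser arXiv:0706.0622, (32)–(35)
and §5. [cite: arXiv07060622, (32)–(35)] -/
theorem bilin_radiusSharp (M : ℝ) {a : ℝ} {x : E4} (hx : 0 < radius a x) (w : E4) :
    bilin M a x (radiusSharp M a x) w = ⟪radiusGradVec a (E4.spatial x), E4.spatial w⟫ := by
  rw [bilin_apply, nullCovector_radiusSharp M hx, radiusSharp, map_sub, map_smul, sub_apply,
    smul_apply, bilin_nullVector, minkowski_bilin_spaceEmbed_left]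
  ring

/-- `⟪∇r, ℓ⃗⟫ = 1` read at a point of `E4`. [cite: arXiv07060622, (34)–(35)] -/
theorem inner_radiusGradVec_nullSpatial {a : ℝ} {x : E4} (hx : 0 < radius a x) :
    ⟪radiusGradVec a (E4.spatial x), nullSpatial a x⟫ = 1 := by
  have hr : 0 < radius a (E4.ofTimeSpace 0 (E4.spatial x)) := by rwa [radius_ofTimeSpace_spatial]
  have h := radiusGrad_nullSpatial (a := a) (E4.time x) hr
  rwa [E4.ofTimeSpace_time_spatial, radiusGrad_apply] at h

/-- **`g(g♯dr, g♯dr) = g^{rr} = Δ(r)/Σ`**, `Δ = r² − 2Mr + a²`, `Σ = blSigma a x⃗` (`= r² + a² cos²θ`):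
`dr(g♯dr) = |∇r|² − 2H dr(ℓ⃗) = (r² + a²)/Σ − 2Mr/Σ`. This is the Boyer–Lindquist `g^{rr} = Δ/ρ²`
read in the Kerr–Schild chart. O'Neill 1995, Ch. 2, §2.5; Visser arXiv:0706.0622, (35).
[cite: ONeill1995, Ch. 2, §2.5] -/
theorem bilin_radiusSharp_self (M : ℝ) {a : ℝ} {x : E4} (hx : 0 < radius a x) :
    bilin M a x (radiusSharp M a x) (radiusSharp M a x) =
      (radius a x ^ 2 - 2 * M * radius a x + a ^ 2) / blSigma a (E4.spatial x) := by
  have hr : 0 < radius a (E4.ofTimeSpace 0 (E4.spatial x)) := by rwa [radius_ofTimeSpace_spatial]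
  have hS : 0 < blSigma a (E4.spatial x) := blSigma_spatial_pos hx
  rw [bilin_radiusSharp M hx, radiusSharp, map_sub, map_smul, E4.spatial_spaceEmbed, inner_sub_right,
    inner_smul_right, inner_radiusGradVec_self hr, radius_ofTimeSpace_spatial,
    show E4.spatial (nullVector a x) = nullSpatial a x from rfl, inner_radiusGradVec_nullSpatial hx,
    scalarH_eq_div_blSigma M a hx]
  field_simp
  ring

/-- The time component of `g♯dr` is `g^{t*r} = 2H` (`(ℓ♯)⁰ = −1`). Visser arXiv:0706.0622, §5.
[cite: arXiv07060622, §5] -/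
theorem radiusSharp_apply_zero (M a : ℝ) (x : E4) : radiusSharp M a x 0 = 2 * scalarH M a x := by
  simp [radiusSharp]

/-- **`g♯dr` is future-directed**: `g(V, g♯dr) = −dt*(g♯dr) = −2H` for the Kerr time orientation
`V = −g♯dt*` (negative for `M > 0`: `r` decreases to the future inside the black hole).
Dafermos–Rodnianski arXiv:0811.0354, §5.1. [cite: arXiv08110354, §5.1] -/
theorem bilin_timeVector_radiusSharp (M : ℝ) {a : ℝ} {x : E4} (hx : 0 < radius a x) :
    bilin M a x (timeVector M a x) (radiusSharp M a x) = -(2 * scalarH M a x) := by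
  rw [bilin_timeVector hx, radiusSharp_apply_zero]

/-- `H = Mr/Σ > 0` for `M > 0` wherever `r > 0` (local copy of `Kerr.scalarH_pos` of
`KerrLeafEnergyComparison.lean`, kept private to avoid that import). Visser arXiv:0706.0622, (33).
[cite: arXiv07060622, (33)] -/
private theorem scalarH_pos_aux {M a : ℝ} (hM : 0 < M) {x : E4} (hx : 0 < radius a x) :
    0 < scalarH M a x := by
  rw [scalarH_eq_div_blSigma M a hx]
  exact div_pos (mul_pos hM hx) (blSigma_spatial_pos hx)

/-- **Between the horizons the cylinder conormal is timelike**: `Δ(r) = r² − 2mr + a² < 0` for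
`r₋ < r < r₊` (`|a| ≤ m`), since `Δ = (r − r₊)(r − r₋)`. O'Neill 1995, Ch. 2, §2.3.
[cite: ONeill1995, Ch. 2, §2.3] -/
theorem delta_neg {m a r : ℝ} (ha : |a| ≤ m) (h₁ : rMinus m a < r) (h₂ : r < rPlus m a) :
    r ^ 2 - 2 * m * r + a ^ 2 < 0 := by
  have ha2 : a ^ 2 ≤ m ^ 2 := by
    have h0 : 0 ≤ |a| := abs_nonneg a
    have : |a| ^ 2 ≤ m ^ 2 := pow_le_pow_left₀ h0 ha 2
    rwa [sq_abs] at this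
  have hs : √(m ^ 2 - a ^ 2) ^ 2 = m ^ 2 - a ^ 2 := Real.sq_sqrt (sub_nonneg.2 ha2)
  have key : r ^ 2 - 2 * m * r + a ^ 2 = (r - rPlus m a) * (r - rMinus m a) := by
    unfold rPlus rMinus
    linear_combination hs
  rw [key]
  exact mul_neg_of_neg_of_pos (sub_neg.2 h₂) (sub_pos.2 h₁)

end Kerr

namespace LiMei

/-! ### Calculus of the Kerr cylinder map -/

/-- The ellipsoid parametrisation `n ↦ (√(r₀² + a²) n₀, √(r₀² + a²) n₁, r₀ n₂)` as a continuous
linear map of `E3`. [cite: arXiv07060622, (32)–(35)] -/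
def ellipsoidCLM (r₀ a : ℝ) : E3 →L[ℝ] E3 :=
  LinearMap.toContinuousLinearMap (IsLinearMap.mk' (ellipsoidPt r₀ a) (by
    constructor
    · intro n n'
      ext i
      fin_cases i <;> simp [ellipsoidPt] <;> ring
    · intro c n
      ext i
      fin_cases i <;> simp [ellipsoidPt] <;> ring))

/-- `ellipsoidCLM r₀ a n = ellipsoidPt r₀ a n`. [folklore] -/
@[simp]
theorem ellipsoidCLM_apply (r₀ a : ℝ) (n : E3) : ellipsoidCLM r₀ a n = ellipsoidPt r₀ a n := rfl

/-- The ellipsoid parametrisation is injective for `0 < r₀` (diagonal with nonzero entries).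
[folklore] -/
theorem ellipsoidPt_eq_zero {r₀ : ℝ} (hr₀ : 0 < r₀) (a : ℝ) {n : E3} (h : ellipsoidPt r₀ a n = 0) :
    n = 0 := by
  have hs : 0 < Real.sqrt (r₀ ^ 2 + a ^ 2) := Real.sqrt_pos.2 (by positivity)
  have h0 := congrArg (fun v : E3 ↦ v 0) h
  have h1 := congrArg (fun v : E3 ↦ v 1) h
  have h2 := congrArg (fun v : E3 ↦ v 2) h
  simp only [ellipsoidPt, PiLp.toLp_apply, Matrix.cons_val_zero, Matrix.cons_val_one,
    Matrix.cons_val, PiLp.zero_apply, mul_eq_zero, hs.ne', hr₀.ne', false_or] at h0 h1 h2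
  ext i
  fin_cases i
  · exact h0
  · exact h1
  · exact h2

/-- The Kerr cylinder map splits as `(‖y‖ + τ₀) ∂_{t*} + (0, ellipsoidPt r₀ a (R (y/‖y‖)))`.
[folklore] -/
theorem kerrCylMap_eq (r₀ a τ₀ : ℝ) (R : E3 →ₗᵢ[ℝ] E3) (y : E3) :
    kerrCylMap r₀ a τ₀ R y = (‖y‖ + τ₀) • E4.basisVector 0 +
      E4.spaceEmbed (ellipsoidCLM r₀ a (R.toContinuousLinearMap (‖y‖⁻¹ • y))) := by
  rw [kerrCylMap, E4.ofTimeSpace_eq_smul_add']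
  rfl

/-- The spatial part of the Kerr cylinder map. [folklore] -/
@[simp]
theorem spatial_kerrCylMap (r₀ a τ₀ : ℝ) (R : E3 →ₗᵢ[ℝ] E3) (y : E3) :
    E4.spatial (kerrCylMap r₀ a τ₀ R y) = ellipsoidPt r₀ a (R (‖y‖⁻¹ • y)) := by
  simp [kerrCylMap]

/-- The Kerr cylinder map lands on `{r = r₀}` (`0 ≤ r₀`, `y ≠ 0`). Visser arXiv:0706.0622, (35).
[cite: arXiv07060622, (35)] -/
theorem radius_kerrCylMap {r₀ : ℝ} (hr₀ : 0 ≤ r₀) (a τ₀ : ℝ) (R : E3 →ₗᵢ[ℝ] E3) {y : E3}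
    (hy : y ≠ 0) : Kerr.radius a (kerrCylMap r₀ a τ₀ R y) = r₀ := by
  have hn : ‖R (‖y‖⁻¹ • y)‖ = 1 := by
    rw [LinearIsometry.norm_map, norm_smul, norm_inv, norm_norm,
      inv_mul_cancel₀ (norm_ne_zero_iff.2 hy)]
  rw [kerrCylMap, radius_ellipsoidPt hr₀ a _ hn]

/-- **The differential of the Kerr cylinder map** at `y ≠ 0`:
`v ↦ (⟪y, v⟫/‖y‖) ∂_{t*} + (0, E R (v/‖y‖ − ⟪y, v⟫ y/‖y‖³))`, `E = ellipsoidCLM r₀ a`. [folklore] -/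
def kerrCylDeriv (r₀ a : ℝ) (R : E3 →ₗᵢ[ℝ] E3) (y : E3) : E3 →L[ℝ] E4 :=
  (‖y‖⁻¹ • E3.covec y).smulRight (E4.basisVector 0) +
    (E4.spaceEmbed.comp ((ellipsoidCLM r₀ a).comp R.toContinuousLinearMap)).comp
      (‖y‖⁻¹ • ContinuousLinearMap.id ℝ E3 + ((-1 / ‖y‖ ^ 3) • E3.covec y).smulRight y)

/-- `kerrCylDeriv r₀ a R y v = (⟪y, v⟫/‖y‖) ∂_{t*} + (0, ellipsoidPt r₀ a (R (‖y‖⁻¹ v + (−⟪y, v⟫/‖y‖³) y)))`.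
[folklore] -/
theorem kerrCylDeriv_apply (r₀ a : ℝ) (R : E3 →ₗᵢ[ℝ] E3) (y v : E3) :
    kerrCylDeriv r₀ a R y v = (‖y‖⁻¹ * ⟪y, v⟫) • E4.basisVector 0 +
      E4.spaceEmbed (ellipsoidPt r₀ a (R (‖y‖⁻¹ • v + (-1 / ‖y‖ ^ 3 * ⟪y, v⟫) • y))) := by
  simp only [kerrCylDeriv, add_apply, ContinuousLinearMap.smulRight_apply, smul_apply,
    E3.covec_apply, smul_eq_mul, ContinuousLinearMap.comp_apply, ContinuousLinearMap.id_apply,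
    ellipsoidCLM_apply, LinearIsometry.coe_toContinuousLinearMap]

/-- The time component of `dψ v` is `⟪y, v⟫/‖y‖`. [folklore] -/
@[simp]
theorem kerrCylDeriv_apply_zero (r₀ a : ℝ) (R : E3 →ₗᵢ[ℝ] E3) (y v : E3) :
    kerrCylDeriv r₀ a R y v 0 = ‖y‖⁻¹ * ⟪y, v⟫ := by
  rw [kerrCylDeriv_apply]
  simp

/-- The spatial part of `dψ v`. [folklore] -/
@[simp]
theorem spatial_kerrCylDeriv (r₀ a : ℝ) (R : E3 →ₗᵢ[ℝ] E3) (y v : E3) :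
    E4.spatial (kerrCylDeriv r₀ a R y v) =
      ellipsoidPt r₀ a (R (‖y‖⁻¹ • v + (-1 / ‖y‖ ^ 3 * ⟪y, v⟫) • y)) := by
  rw [kerrCylDeriv_apply]
  simp

/-- **The Kerr cylinder map is differentiable off the origin, with differential `kerrCylDeriv`.**
[folklore] -/
theorem hasFDerivAt_kerrCylMap (r₀ a τ₀ : ℝ) (R : E3 →ₗᵢ[ℝ] E3) {y : E3} (hy : y ≠ 0) :
    HasFDerivAt (kerrCylMap r₀ a τ₀ R) (kerrCylDeriv r₀ a R y) y := by
  have hfun : kerrCylMap r₀ a τ₀ R = fun y : E3 ↦ (‖y‖ + τ₀) • E4.basisVector 0 +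
      (E4.spaceEmbed.comp ((ellipsoidCLM r₀ a).comp R.toContinuousLinearMap))
        ((‖y‖ ^ 1)⁻¹ • y) := by
    funext z; rw [kerrCylMap_eq, pow_one]; rfl
  rw [hfun]
  have h1 : HasFDerivAt (fun y : E3 ↦ (‖y‖ + τ₀) • E4.basisVector 0)
      ((‖y‖⁻¹ • E3.covec y).smulRight (E4.basisVector 0)) y :=
    ((Kerr.hasFDerivAt_norm_E3 hy).add_const τ₀).smul_const _
  have h2 : HasFDerivAt (fun y : E3 ↦ (‖y‖ ^ 1)⁻¹ • y)
      ((‖y‖ ^ 1)⁻¹ • ContinuousLinearMap.id ℝ E3 +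
        (((-(1 : ℕ) : ℝ) / ‖y‖ ^ (1 + 2)) • E3.covec y).smulRight y) y :=
    (Kerr.hasFDerivAt_inv_norm_pow hy 1).smul (hasFDerivAt_id y)
  have h3 := (E4.spaceEmbed.comp ((ellipsoidCLM r₀ a).comp R.toContinuousLinearMap)).hasFDerivAt.comp
    y h2
  refine (h1.add h3).congr_fderiv ?_
  simp only [kerrCylDeriv, pow_one, Nat.cast_one]

/-- The Kerr cylinder map is differentiable off the origin. [folklore] -/
theorem differentiableAt_kerrCylMap (r₀ a τ₀ : ℝ) (R : E3 →ₗᵢ[ℝ] E3) {y : E3} (hy : y ≠ 0) :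
    DifferentiableAt ℝ (kerrCylMap r₀ a τ₀ R) y :=
  (hasFDerivAt_kerrCylMap r₀ a τ₀ R hy).differentiableAt

/-- `Dψ(y) = kerrCylDeriv r₀ a R y` off the origin. [folklore] -/
theorem fderiv_kerrCylMap (r₀ a τ₀ : ℝ) (R : E3 →ₗᵢ[ℝ] E3) {y : E3} (hy : y ≠ 0) :
    fderiv ℝ (kerrCylMap r₀ a τ₀ R) y = kerrCylDeriv r₀ a R y :=
  (hasFDerivAt_kerrCylMap r₀ a τ₀ R hy).fderiv

/-- **The Kerr cylinder map is `C^n` off the origin** for every `n`. [folklore] -/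
theorem contDiffAt_kerrCylMap (r₀ a τ₀ : ℝ) (R : E3 →ₗᵢ[ℝ] E3) {y : E3} (hy : y ≠ 0)
    {n : WithTop ℕ∞} : ContDiffAt ℝ n (kerrCylMap r₀ a τ₀ R) y := by
  have hfun : kerrCylMap r₀ a τ₀ R = fun y : E3 ↦ (‖y‖ + τ₀) • E4.basisVector 0 +
      (E4.spaceEmbed.comp ((ellipsoidCLM r₀ a).comp R.toContinuousLinearMap)) (‖y‖⁻¹ • y) := by
    funext z; rw [kerrCylMap_eq]; rfl
  rw [hfun]
  have hn : ContDiffAt ℝ n (fun y : E3 ↦ ‖y‖) y := contDiffAt_norm ℝ hy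
  have h1 : ContDiffAt ℝ n (fun y : E3 ↦ (‖y‖ + τ₀) • E4.basisVector 0) y :=
    (hn.add contDiffAt_const).smul contDiffAt_const
  have h2 : ContDiffAt ℝ n (fun y : E3 ↦ ‖y‖⁻¹ • y) y :=
    (hn.inv (norm_ne_zero_iff.2 hy)).smul contDiffAt_id
  exact h1.add ((E4.spaceEmbed.comp ((ellipsoidCLM r₀ a).comp
    R.toContinuousLinearMap)).contDiff.contDiffAt.comp y h2)

/-- **The differential of the Kerr cylinder map is injective** (`0 < r₀`, `y ≠ 0`): if `dψ v = 0`
then `⟪y, v⟫ = 0` (time component) and `E R (v/‖y‖) = 0` (spatial component), so `v = 0`.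
[folklore] -/
theorem kerrCylDeriv_injective {r₀ : ℝ} (hr₀ : 0 < r₀) (a : ℝ) (R : E3 →ₗᵢ[ℝ] E3) {y : E3}
    (hy : y ≠ 0) : Function.Injective (kerrCylDeriv r₀ a R y) := by
  have hn : ‖y‖ ≠ 0 := norm_ne_zero_iff.2 hy
  refine (injective_iff_map_eq_zero _).2 fun v hv ↦ ?_
  have h0 : ⟪y, v⟫ = 0 := by
    have h := congrArg (fun w : E4 ↦ w 0) hv
    simp only [kerrCylDeriv_apply_zero, PiLp.zero_apply, mul_eq_zero, inv_eq_zero, hn,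
      false_or] at h
    exact h
  have hsp := congrArg E4.spatial hv
  rw [spatial_kerrCylDeriv, h0, mul_zero, zero_smul, add_zero, map_zero] at hsp
  have h1 : R (‖y‖⁻¹ • v) = 0 := ellipsoidPt_eq_zero hr₀ a hsp
  have h2 : ‖y‖⁻¹ • v = 0 := by
    have := congrArg norm h1
    rwa [LinearIsometry.norm_map, norm_zero, norm_eq_zero] at this
  rcases smul_eq_zero.1 h2 with h | h
  · exact absurd h (inv_ne_zero hn)
  · exact h

/-- Off the origin the Kerr cylinder map stays on `{r = r₀}`, as a germ. [folklore] -/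
theorem eventually_radius_kerrCylMap {r₀ : ℝ} (hr₀ : 0 ≤ r₀) (a τ₀ : ℝ) (R : E3 →ₗᵢ[ℝ] E3)
    {y : E3} (hy : y ≠ 0) :
    (fun z : E3 ↦ Kerr.radius a (kerrCylMap r₀ a τ₀ R z)) =ᶠ[𝓝 y] fun _ ↦ r₀ := by
  filter_upwards [isOpen_ne.mem_nhds hy] with z hz
  exact radius_kerrCylMap hr₀ a τ₀ R hz

/-- **Tangency: `dr(dψ v) = 0`** — the Kerr cylinder map lands in `{r = r₀}`, so
`D(r ∘ ψ)(y) = dr ∘ dψ(y) = 0`, i.e. `⟪∇r, (dψ v)⃗⟫ = 0` for every `v` (`0 < r₀`, `y ≠ 0`).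
[cite: arXiv07060622, (35)] -/
theorem inner_radiusGradVec_kerrCylDeriv {r₀ : ℝ} (hr₀ : 0 < r₀) (a τ₀ : ℝ) (R : E3 →ₗᵢ[ℝ] E3)
    {y : E3} (hy : y ≠ 0) (v : E3) :
    ⟪Kerr.radiusGradVec a (E4.spatial (kerrCylMap r₀ a τ₀ R y)),
      E4.spatial (kerrCylDeriv r₀ a R y v)⟫ = 0 := by
  have hx : 0 < Kerr.radius a (kerrCylMap r₀ a τ₀ R y) := by
    rw [radius_kerrCylMap hr₀.le a τ₀ R hy]; exact hr₀
  have h0 : HasFDerivAt (fun z : E3 ↦ Kerr.radius a (kerrCylMap r₀ a τ₀ R z)) (0 : E3 →L[ℝ] ℝ) y :=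
    (hasFDerivAt_const r₀ y).congr_of_eventuallyEq (eventually_radius_kerrCylMap hr₀.le a τ₀ R hy)
  have h1 : HasFDerivAt (fun z : E3 ↦ Kerr.radius a (kerrCylMap r₀ a τ₀ R z))
      (((Kerr.radiusGrad a (E4.spatial (kerrCylMap r₀ a τ₀ R y))).comp E4.spatial).comp
        (kerrCylDeriv r₀ a R y)) y :=
    (Kerr.hasFDerivAt_radius hx).comp y (hasFDerivAt_kerrCylMap r₀ a τ₀ R hy)
  have h := DFunLike.congr_fun (h0.unique h1) v
  simp only [zero_apply, ContinuousLinearMap.comp_apply, Kerr.radiusGrad_apply] at h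
  exact h.symm

/-! ### The Kerr cylinder frame is a spacelike immersion -/

/-- A pinned Kerr cylinder frame `ψ` (`(ψ y : E4) = kerrCylMap r₀ a τ₀ R y`) is `C^n` for every
`n`, as a map of manifolds `Kerr.slice 0 1 → Kerr.region a r₁`. [folklore] -/
theorem contMDiff_kerrCyl {a r₁ r₀ τ₀ : ℝ} {R : E3 →ₗᵢ[ℝ] E3}
    {ψ : Kerr.slice 0 1 → Kerr.region a r₁}
    (hψ : ∀ y, (ψ y : E4) = kerrCylMap r₀ a τ₀ R (y : E3)) (n : ℕ∞ω) :
    ContMDiff 𝓘(ℝ, E3) 𝓘(ℝ, E4) n ψ := fun y ↦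
  (ChartedSpace.liftPropWithinAt_subtypeVal_comp_iff ψ Set.univ y).mp
    ((OpensChart.contMDiffAt_iff y (Subtype.val ∘ ψ) (kerrCylMap r₀ a τ₀ R) (fun z ↦ hψ z)).2
      (contDiffAt_kerrCylMap r₀ a τ₀ R (ne_zero_of_mem_slice y)))

/-- **The Kerr cylinder `{r = r₀}`, `r₋ < r₀ < r₊`, is a smooth spacelike immersion** (every spin
`|a| < m`, any time shift `τ₀` and axis rotation `R`): for the pinned frame `ψ` of
`LiMei.IsKerrCylinderOn`, `dψ` is injective and its values are `g`-orthogonal to the timelike vector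
`g♯dr` (`g(g♯dr, g♯dr) = Δ/Σ < 0`, `g(g♯dr, dψ v) = dr(dψ v) = 0`), hence spacelike
(`Kerr.bilin_pos_of_orthogonal`, O'Neill 1983, Ch. 5, Lemma 5.26). Li–Mei arXiv:2005.01249, §4,
p. 22 ("for any `r₀ ∈ (r₋, r₊)`, the hypersurface `r = r₀` is a spacelike hypersurface inside the
black hole"); O'Neill 1995, Ch. 2, §2.5. [cite: LiMei2020, §4] -/
theorem isSpacelikeImmersion_kerrCyl [Kerr.Facts] {m a r₁ r₀ : ℝ} (ha : |a| < m)
    (h₁ : Kerr.rMinus m a < r₀) (h₂ : r₀ < Kerr.rPlus m a) (τ₀ : ℝ) (R : E3 →ₗᵢ[ℝ] E3)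
    {ψ : Kerr.slice 0 1 → Kerr.region a r₁}
    (hψ : ∀ y, (ψ y : E4) = kerrCylMap r₀ a τ₀ R (y : E3)) :
    (Kerr.smoothMetric m a r₁).IsSpacelikeImmersion 𝓘(ℝ, E3) ψ := by
  have hr₀ : 0 < r₀ := (Kerr.IsSubextremal.rMinus_nonneg ha).trans_lt h₁
  refine ⟨contMDiff_kerrCyl hψ _, fun y v hv ↦ ?_⟩
  have hy : (y : E3) ≠ 0 := ne_zero_of_mem_slice y
  have hx : 0 < Kerr.radius a (ψ y : E4) := by
    rw [hψ y, radius_kerrCylMap hr₀.le a τ₀ R hy]; exact hr₀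
  rw [PseudoRiemannianMetric.inducedBilin_apply,
    OpensChart.mfderiv_apply_of_repr hψ (differentiableAt_kerrCylMap r₀ a τ₀ R hy),
    fderiv_kerrCylMap r₀ a τ₀ R hy, Kerr.smoothMetric_val]
  -- `g♯dr` is timelike at `ψ y` and orthogonal to `dψ v ≠ 0`
  have hnn : Kerr.bilin m a (ψ y : E4) (Kerr.radiusSharp m a (ψ y : E4))
      (Kerr.radiusSharp m a (ψ y : E4)) < 0 := by
    rw [Kerr.bilin_radiusSharp_self m hx, hψ y, radius_kerrCylMap hr₀.le a τ₀ R hy]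
    exact div_neg_of_neg_of_pos (Kerr.delta_neg ha.le h₁ h₂)
      (Kerr.blSigma_spatial_pos (by rw [radius_kerrCylMap hr₀.le a τ₀ R hy]; exact hr₀))
  have hnw : Kerr.bilin m a (ψ y : E4) (Kerr.radiusSharp m a (ψ y : E4))
      (kerrCylDeriv r₀ a R (y : E3) v) = 0 := by
    rw [Kerr.bilin_radiusSharp m hx, hψ y]
    exact inner_radiusGradVec_kerrCylDeriv hr₀ a τ₀ R hy v
  have hw : kerrCylDeriv r₀ a R (y : E3) v ≠ 0 := fun h ↦
    hv ((kerrCylDeriv_injective hr₀ a R hy) (h.trans (map_zero _).symm))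
  exact Kerr.bilin_pos_of_orthogonal m a hx _ _ hnn hnw hw

/-! ### The future unit normal of the Kerr cylinder -/

/-- **The future unit normal of the cylinders `{r = const}` between the horizons**, as a function
on the chart: `ν = (−g(g♯dr, g♯dr))^{-1/2} g♯dr = (−Δ/Σ)^{-1/2} ((0, ∇r) − 2H ℓ♯)` (junk value
where `Δ ≥ 0`: `Real.sqrt` of a nonpositive number is `0`, `0⁻¹ = 0`). For `a = 0` this is the
normal `(2M/r₀ − 1)^{-1/2} ((2M/r₀) ∂_{t*} + (1 − 2M/r₀)(0, y/‖y‖))` of the Schwarzschild cylinder.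
O'Neill 1995, Ch. 2, §2.5; Wald 1984, §10.2. [cite: ONeill1995, Ch. 2, §2.5] -/
def kerrCylUnitNormal (m a : ℝ) (x : E4) : E4 :=
  (√(-Kerr.bilin m a x (Kerr.radiusSharp m a x) (Kerr.radiusSharp m a x)))⁻¹ • Kerr.radiusSharp m a x

/-- **The Kerr cylinder frame has the future unit normal `kerrCylUnitNormal`** (`0 ≤ m` for the
time orientation, `|a| < m`, `r₋ < r₀ < r₊`): `g(ν, dψ v) = c dr(dψ v) = 0`, `g(ν, ν) = −1`
(`c² = −1/g(g♯dr, g♯dr)`), and `g(V, ν) = −2Hc < 0`. The `IsFutureUnitNormal` clause of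
`LiMei.IsKerrCylinderOn` is thus satisfiable for all admissible parameters. Li–Mei
arXiv:2005.01249, §4, p. 22; Wald 1984, §10.2. [cite: LiMei2020, §4] -/
theorem isFutureUnitNormal_kerrCylUnitNormal [Kerr.Facts] {m a r₁ r₀ : ℝ} (hm : 0 ≤ m)
    (ha : |a| < m) (h₁ : Kerr.rMinus m a < r₀) (h₂ : r₀ < Kerr.rPlus m a) (τ₀ : ℝ)
    (R : E3 →ₗᵢ[ℝ] E3) {ψ : Kerr.slice 0 1 → Kerr.region a r₁}
    (hψ : ∀ y, (ψ y : E4) = kerrCylMap r₀ a τ₀ R (y : E3)) :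
    (Kerr.smoothMetric m a r₁).IsFutureUnitNormal 𝓘(ℝ, E3)
      ((Kerr.timeOrientation m a r₁ hm).ofLE le_top) ψ
      (fun y ↦ kerrCylUnitNormal m a (ψ y : E4)) := by
  have hr₀ : 0 < r₀ := (Kerr.IsSubextremal.rMinus_nonneg ha).trans_lt h₁
  have hm0 : 0 < m := Kerr.IsSubextremal.pos ha
  -- pointwise facts at `x = ψ y`
  have key : ∀ y : Kerr.slice 0 1, 0 < Kerr.radius a (ψ y : E4) ∧
      Kerr.bilin m a (ψ y : E4) (Kerr.radiusSharp m a (ψ y : E4))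
        (Kerr.radiusSharp m a (ψ y : E4)) < 0 := fun y ↦ by
    have hy : (y : E3) ≠ 0 := ne_zero_of_mem_slice y
    have hx : 0 < Kerr.radius a (ψ y : E4) := by
      rw [hψ y, radius_kerrCylMap hr₀.le a τ₀ R hy]; exact hr₀
    refine ⟨hx, ?_⟩
    rw [Kerr.bilin_radiusSharp_self m hx, hψ y, radius_kerrCylMap hr₀.le a τ₀ R hy]
    exact div_neg_of_neg_of_pos (Kerr.delta_neg ha.le h₁ h₂)
      (Kerr.blSigma_spatial_pos (by rw [radius_kerrCylMap hr₀.le a τ₀ R hy]; exact hr₀))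
  have hunit : ∀ y : Kerr.slice 0 1, (Kerr.smoothMetric m a r₁).val (ψ y)
      (kerrCylUnitNormal m a (ψ y : E4)) (kerrCylUnitNormal m a (ψ y : E4)) = -1 := fun y ↦ by
    obtain ⟨_, hq⟩ := key y
    set q := Kerr.bilin m a (ψ y : E4) (Kerr.radiusSharp m a (ψ y : E4))
      (Kerr.radiusSharp m a (ψ y : E4)) with hq_def
    have hs : √(-q) ^ 2 = -q := Real.sq_sqrt (by linarith)
    have hs0 : √(-q) ≠ 0 := (Real.sqrt_pos.2 (by linarith)).ne'
    rw [Kerr.smoothMetric_val]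
    show Kerr.bilin m a (ψ y : E4) (kerrCylUnitNormal m a (ψ y : E4))
      (kerrCylUnitNormal m a (ψ y : E4)) = -1
    rw [kerrCylUnitNormal, map_smul, map_smul, smul_apply, smul_eq_mul, smul_eq_mul, ← hq_def]
    have hc2 : (√(-q))⁻¹ * (√(-q))⁻¹ = (-q)⁻¹ := by rw [← mul_inv, ← sq, hs]
    rw [← mul_assoc, hc2, inv_mul_eq_div, div_neg_eq_neg_div, div_self hq.ne]
  refine ⟨⟨fun y v ↦ ?_, hunit⟩, fun y ↦ ⟨?_, ?_⟩⟩
  · -- normal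
    have hy : (y : E3) ≠ 0 := ne_zero_of_mem_slice y
    obtain ⟨hx, _⟩ := key y
    rw [OpensChart.mfderiv_apply_of_repr hψ (differentiableAt_kerrCylMap r₀ a τ₀ R hy),
      fderiv_kerrCylMap r₀ a τ₀ R hy, Kerr.smoothMetric_val]
    show Kerr.bilin m a (ψ y : E4) (kerrCylUnitNormal m a (ψ y : E4))
      (kerrCylDeriv r₀ a R (y : E3) v) = 0
    rw [kerrCylUnitNormal, map_smul, smul_apply, smul_eq_mul]
    refine mul_eq_zero_of_right _ ?_
    have h := inner_radiusGradVec_kerrCylDeriv hr₀ a τ₀ R hy (v : E3)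
    rw [← hψ y] at h
    rw [Kerr.bilin_radiusSharp m hx]
    exact h
  · -- causal
    have ht : (Kerr.smoothMetric m a r₁).IsTimelike (x := ψ y)
        (kerrCylUnitNormal m a (ψ y : E4)) := by
      rw [LorentzianMetric.isTimelike_iff]
      exact (hunit y) ▸ neg_one_lt_zero
    exact ht.isCausal
  · -- future
    obtain ⟨hx, hq⟩ := key y
    rw [TimeOrientation.vectorField_ofLE, Kerr.smoothMetric_val]
    show Kerr.bilin m a (ψ y : E4) (Kerr.timeVector m a (ψ y : E4))
      (kerrCylUnitNormal m a (ψ y : E4)) < 0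
    rw [kerrCylUnitNormal, map_smul, smul_eq_mul, Kerr.bilin_timeVector_radiusSharp m hx]
    have hc : 0 < (√(-Kerr.bilin m a (ψ y : E4) (Kerr.radiusSharp m a (ψ y : E4))
        (Kerr.radiusSharp m a (ψ y : E4))))⁻¹ := inv_pos.2 (Real.sqrt_pos.2 (by linarith))
    have hH := Kerr.scalarH_pos_aux hm0 hx
    nlinarith

/-- **Uniqueness: every future unit normal of the pinned Kerr cylinder frame is `kerrCylUnitNormal`**
(codimension-one spacelike immersion, `LorentzianMetric.IsFutureUnitNormal.apply_eq`); the `∃ ν`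
of `LiMei.IsKerrCylinderOn` is pinned pointwise. O'Neill 1983, Ch. 5, p. 145. [cite: LiMei2020, §4] -/
theorem eq_kerrCylUnitNormal [Kerr.Facts] {m a r₁ r₀ : ℝ} (hm : 0 ≤ m) (ha : |a| < m)
    (h₁ : Kerr.rMinus m a < r₀) (h₂ : r₀ < Kerr.rPlus m a) (τ₀ : ℝ) (R : E3 →ₗᵢ[ℝ] E3)
    {ψ : Kerr.slice 0 1 → Kerr.region a r₁} (hψ : ∀ y, (ψ y : E4) = kerrCylMap r₀ a τ₀ R (y : E3))
    {ν : NormalField 𝓘(ℝ, E4) ψ}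
    (hν : (Kerr.smoothMetric m a r₁).IsFutureUnitNormal 𝓘(ℝ, E3)
      ((Kerr.timeOrientation m a r₁ hm).ofLE le_top) ψ ν) (y : Kerr.slice 0 1) :
    ν y = kerrCylUnitNormal m a (ψ y : E4) :=
  (isFutureUnitNormal_kerrCylUnitNormal hm ha h₁ h₂ τ₀ R hψ).apply_eq
    (by rw [finrank_euclideanSpace_fin, finrank_euclideanSpace_fin])
    (isSpacelikeImmersion_kerrCyl ha h₁ h₂ τ₀ R hψ) hν y

end LiMei

end Literature.Geometry.Lorentzian

end
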